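import Mathlib
import HarnessLib

/-!
# `L`-lag couplings bound the distance to stationarity:
# `d_TV(π_t, π) ≤ E[max(0, ⌈(τ^{(L)} − L − t)/L⌉)]` (Biswas–Jacob–Vanetti 2019, Theorem 2.5,
# total-variation case)

HONEST FRAMING: exact (Metropolis-corrected) sampling algorithms for lattice gauge theory;
figures of merit are autocorrelation/cost numbers at stated couplings and volumes; no
continuum-physics claim.

Topic `Probability/MarkovChains` (companions: `MarkovianCoupling.lean` — the coupling inequality
and Levin–Peres Cor. 5.5 on a finite state space; `UnbiasedMcmcCouplings.lean` — the `L = 1`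
unbiased estimator of Jacob–O'Leary–Atchadé under the same kind of assumptions;
`CouplingFromThePast.lean`).  PUBLISHED RESULT with our formalisation (Mathlib measures, `tsum`,
limits); every statement proved, no named fact.

Source (READ at the locators).  N. Biswas, P. E. Jacob, P. Vanetti, *Estimating convergence of
Markov chains with L-lag couplings*, NeurIPS 2019 [arXiv:1905.09971] [BiswasJacobVanetti2019]:
* §2.1 **Assumption 2.2** ("Marginal convergence and moments.  For all `h ∈ ℋ`, as `t → ∞`,
  `E[h(X_t)] → E_{X∼π}[h(X)]` …"), **Assumption 2.3** ("the meeting time `τ^{(L)} := inf{t > L :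
  X_t = Y_{t−L}}` satisfies `P((τ^{(L)} − L)/L > t) ≤ C δ^t`"), **Assumption 2.4** ("Faithfulness.
  The chains stay together after meeting: `X_t = Y_{t−L}` for all `t ≥ τ^{(L)}`"); the chains
  "marginally have the same initial distribution `π_0` and Markov transition kernel `K`" (§6.1);
* **Theorem 2.5** (Upper bounds) and its total-variation case (2.1): "for any `L ≥ 1`, and any
  `t ≥ 0`, … `d_TV(π_t, π) ≤ E[max(0, ⌈(τ^{(L)} − L − t)/L⌉)]`";
* the printed sketch: "Seeing the invariant distribution `π` as the limit of `π_t` as `t → ∞`,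
  applying triangle inequalities, recalling that `d_ℋ(π_s, π_t) ≤ E[M_ℋ(X_s, X_t)]` for all `s, t`,
  we obtain `d_ℋ(π_t, π) ≤ Σ_{j=1}^{∞} d_ℋ(π_{t+jL}, π_{t+(j−1)L}) ≤ Σ_{j=1}^{∞} E[M_ℋ(X_{t+jL},
  X_{t+(j−1)L})]`.  The right-hand side of (eq:ipm_upper_bound) is retrieved by swapping
  expectation and limit, and noting that terms indexed by `j > ⌈(τ^{(L)} − L − t)/L⌉` are equal to
  zero by Assumption 2.4."

Lean reading (one probability space `(Ω, P)`; as in `UnbiasedMcmcCouplings.lean` the Markov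
kernel enters only through the assumptions, which we take as hypotheses — `Assumptions`):
* `X Y : ℕ → Ω → 𝒳`, the lag `L ≥ 1`, `τ : Ω → ℕ` the meeting time `τ^{(L)}`, `target` = `π`;
  `identDistrib t : IdentDistrib (X t) (Y t) P P` (same marginal laws `π_t`); Assumption 2.2 in
  the form the TOTAL-VARIATION case uses: `π_t(B) → π(B)` for every measurable `B` (`tendsto`);
  Assumption 2.4 = `faithful`.  Assumption 2.3 (the tail bound) is NOT needed for the inequality —
  it only makes the right-hand side finite — and is not assumed.
* THE BOUND is stated set-wise, which is the total-variation statement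
  (`d_TV(π_t, π) = sup_B |π_t(B) − π(B)|`): for every measurable `B`,
  `π_t(B) ≤ π(B) + Σ_{j≥1} P(τ > t + jL)` and `π(B) ≤ π_t(B) + Σ_{j≥1} P(τ > t + jL)`
  (`measure_le_target_add`, `target_le_measure_add`), and
  `Σ_{j≥1} P(τ > t + jL) = E[#{j ≥ 1 : t + jL < τ}] = E[⌊(τ − t − 1)/L⌋]` (`tsum_measure_eq_lintegral`,
  natural-number subtraction and division), which is the printed `E[max(0, ⌈(τ − L − t)/L⌉)]`
  because `⌈n/L⌉ − 1 = ⌊(n − 1)/L⌋` for integers `n ≥ 1` and both sides vanish for `τ ≤ t`.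
* The proof is the printed sketch made exact: one lag step is the coupling inequality
  `π_s(B) = P(Y_s ∈ B) ≤ P(X_{s+L} ∈ B) + P(X_{s+L} ≠ Y_s) ≤ π_{s+L}(B) + P(τ > s + L)`
  (`measure_Y_le`, faithfulness), `n` steps telescope (`measure_le_add_sum`), and `n → ∞` uses
  `π_{t+nL}(B) → π(B)`.

Contents (all proved): `Assumptions`, `measure_X_eq_Y`, `measure_Y_le`, `measure_X_le`,
`measure_le_add_sum`, `measure_add_sum_ge`, **`measure_le_target_add`**, **`target_le_measure_add`**
(THEOREM 2.5, TV case, both one-sided forms), `count_eq`, **`tsum_measure_eq_lintegral`** (the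
right-hand side as the printed expectation), `count_eq_max_ceil` (the integrand IS the printed
`max(0, ⌈(τ − L − t)/L⌉)`), `Assumptions.of_const` (the hypotheses are jointly satisfiable).

* **IPM / one-test-function form of Theorem 2.5** (appended section): `integral_X_eq_Y`,
  `ofReal_abs_sub_le_step`, `ofReal_abs_sub_le_sum`, **`integral_sub_target_le`** (`|E h(X_t) −
  E_π h| ≤ E[Σ_j 1{t+jL<τ} M(X_{t+jL}, Y_{t+(j−1)L})]` whenever `|h(x) − h(y)| ≤ M(x,y)` and
  `E h(X_t) → E_π h`), **`integral_sub_target_le_of_lipschitz`** (the 1-Wasserstein case (2.2), one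
  1-Lipschitz `h` at a time, `M = d_𝒳`).

Deliberate omissions / TODO(general form): the supremum over a function CLASS `ℋ` (the IPM itself)
is left to the reader of `integral_sub_target_le` (one `h` at a time is what is typed);
Proposition 6.1 (the `L`-lag unbiased estimator; `L = 1` is `UnbiasedMcmcCouplings.lean`) and §6.3
(SMC bias) are not formalised.

Context (cell pub-lqcd, HOME/R2-SCOPE.md cost thread): a COMPUTABLE, assumption-explicit upper bound
on the distance to stationarity after `t` steps from simulated meeting times — a burn-in / cost
certificate of exactly the printed strength, nothing more.
-/

noncomputable section

namespace Literature.Probability.MarkovChains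

open _root_.MeasureTheory _root_.ProbabilityTheory Filter Topology Finset
open scoped ENNReal NNReal

namespace LLagCoupling

variable {Ω : Type*} {𝒳 : Type*} [MeasurableSpace Ω] [MeasurableSpace 𝒳]

/-- **The setting of §2 with Assumptions 2.2 (total-variation form) and 2.4** for two chains
`X`, `Y` on one probability space, coupled with LAG `L ≥ 1`, their meeting time `τ = τ^{(L)}` and
the target law `π`. [cite: BiswasJacobVanetti2019, §2.1 Assumptions 2.2–2.4] -/
structure Assumptions (P : Measure Ω) (X Y : ℕ → Ω → 𝒳) (τ : Ω → ℕ) (L : ℕ)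
    (target : Measure 𝒳) : Prop where
  /-- "for any `L ≥ 1`". -/
  one_le : 1 ≤ L
  /-- the chains are measurable processes. -/
  measurable_X : ∀ t, Measurable (X t)
  measurable_Y : ∀ t, Measurable (Y t)
  /-- "marginally have the same initial distribution `π_0` and Markov transition kernel `K`":
  `X_t` and `Y_t` have the same law `π_t`. -/
  identDistrib : ∀ t, IdentDistrib (X t) (Y t) P P
  /-- Assumption 2.2, total-variation form: `π_t(B) → π(B)` for every event `B`. -/
  tendsto : ∀ B : Set 𝒳, MeasurableSet B → Tendsto (fun t => P (X t ⁻¹' B)) atTop (𝓝 (target B))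
  /-- the meeting time is a random variable. -/
  measurable_τ : Measurable τ
  /-- Assumption 2.4: "`X_t = Y_{t−L}` for all `t ≥ τ^{(L)}`". -/
  faithful : ∀ ω t, τ ω ≤ t → X t ω = Y (t - L) ω

namespace Assumptions

variable {P : Measure Ω} {X Y : ℕ → Ω → 𝒳} {τ : Ω → ℕ} {L : ℕ} {target : Measure 𝒳}
  (A : Assumptions P X Y τ L target)
include A

/-- Same marginals: `P(X_t ∈ B) = P(Y_t ∈ B)`. [cite: BiswasJacobVanetti2019, §6.1 ("marginally
have the same initial distribution `π_0` and Markov transition kernel `K`")] -/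
theorem measure_X_eq_Y (t : ℕ) {B : Set 𝒳} (hB : MeasurableSet B) :
    P (X t ⁻¹' B) = P (Y t ⁻¹' B) :=
  (A.identDistrib t).measure_mem_eq hB

/-- **One lag step (the coupling inequality with faithfulness)**:
`P(Y_s ∈ B) ≤ P(X_{s+L} ∈ B) + P(τ > s + L)`. [cite: BiswasJacobVanetti2019, §2.1 (sketch:
"`d_ℋ(π_s, π_t) ≤ E[M_ℋ(X_s, X_t)]`" and "terms indexed by `j > ⌈(τ^{(L)} − L − t)/L⌉` are equal
to zero by Assumption 2.4")] -/
theorem measure_Y_le (s : ℕ) (B : Set 𝒳) :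
    P (Y s ⁻¹' B) ≤ P (X (s + L) ⁻¹' B) + P {ω | s + L < τ ω} := by
  calc P (Y s ⁻¹' B) ≤ P (X (s + L) ⁻¹' B ∪ {ω | s + L < τ ω}) := by
        refine measure_mono fun ω hω => ?_
        by_cases hτ : τ ω ≤ s + L
        · left
          show X (s + L) ω ∈ B
          rw [A.faithful ω (s + L) hτ, Nat.add_sub_cancel]
          exact hω
        · right
          exact not_le.1 hτ
    _ ≤ P (X (s + L) ⁻¹' B) + P {ω | s + L < τ ω} := measure_union_le _ _

/-- The same step in the other direction: `P(X_{s+L} ∈ B) ≤ P(Y_s ∈ B) + P(τ > s + L)`.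
[cite: BiswasJacobVanetti2019, §2.1 (sketch)] -/
theorem measure_X_le (s : ℕ) (B : Set 𝒳) :
    P (X (s + L) ⁻¹' B) ≤ P (Y s ⁻¹' B) + P {ω | s + L < τ ω} := by
  calc P (X (s + L) ⁻¹' B) ≤ P (Y s ⁻¹' B ∪ {ω | s + L < τ ω}) := by
        refine measure_mono fun ω hω => ?_
        by_cases hτ : τ ω ≤ s + L
        · left
          show Y s ω ∈ B
          have e := A.faithful ω (s + L) hτ
          rw [Nat.add_sub_cancel] at e
          rw [← e]
          exact hω
        · right
          exact not_le.1 hτ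
    _ ≤ P (Y s ⁻¹' B) + P {ω | s + L < τ ω} := measure_union_le _ _

/-- **`n` lag steps, telescoped** ("applying triangle inequalities"):
`π_t(B) ≤ π_{t+nL}(B) + Σ_{j=1}^{n} P(τ > t + jL)`. [cite: BiswasJacobVanetti2019, §2.1 (sketch)] -/
theorem measure_le_add_sum (t n : ℕ) {B : Set 𝒳} (hB : MeasurableSet B) :
    P (X t ⁻¹' B) ≤ P (X (t + n * L) ⁻¹' B) + ∑ j ∈ range n, P {ω | t + (j + 1) * L < τ ω} := by
  induction n with
  | zero => simp
  | succ n ih =>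
    calc P (X t ⁻¹' B)
        ≤ P (X (t + n * L) ⁻¹' B) + ∑ j ∈ range n, P {ω | t + (j + 1) * L < τ ω} := ih
      _ = P (Y (t + n * L) ⁻¹' B) + ∑ j ∈ range n, P {ω | t + (j + 1) * L < τ ω} := by
          rw [A.measure_X_eq_Y _ hB]
      _ ≤ (P (X (t + n * L + L) ⁻¹' B) + P {ω | t + n * L + L < τ ω}) +
            ∑ j ∈ range n, P {ω | t + (j + 1) * L < τ ω} := by
          gcongr
          exact A.measure_Y_le _ B
      _ = P (X (t + (n + 1) * L) ⁻¹' B) + ∑ j ∈ range (n + 1), P {ω | t + (j + 1) * L < τ ω} := by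
          rw [Finset.sum_range_succ, add_mul, one_mul, ← add_assoc]
          ring

/-- The telescoped bound in the other direction: `π_{t+nL}(B) ≤ π_t(B) + Σ_{j=1}^{n} P(τ > t + jL)`.
[cite: BiswasJacobVanetti2019, §2.1 (sketch)] -/
theorem measure_add_sum_ge (t n : ℕ) {B : Set 𝒳} (hB : MeasurableSet B) :
    P (X (t + n * L) ⁻¹' B) ≤ P (X t ⁻¹' B) + ∑ j ∈ range n, P {ω | t + (j + 1) * L < τ ω} := by
  induction n with
  | zero => simp
  | succ n ih =>
    calc P (X (t + (n + 1) * L) ⁻¹' B)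
        = P (X (t + n * L + L) ⁻¹' B) := by rw [add_mul, one_mul, ← add_assoc]
      _ ≤ P (Y (t + n * L) ⁻¹' B) + P {ω | t + n * L + L < τ ω} := A.measure_X_le _ B
      _ = P (X (t + n * L) ⁻¹' B) + P {ω | t + n * L + L < τ ω} := by rw [A.measure_X_eq_Y _ hB]
      _ ≤ (P (X t ⁻¹' B) + ∑ j ∈ range n, P {ω | t + (j + 1) * L < τ ω}) +
            P {ω | t + n * L + L < τ ω} := by
          gcongr
      _ = P (X t ⁻¹' B) + ∑ j ∈ range (n + 1), P {ω | t + (j + 1) * L < τ ω} := by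
          rw [Finset.sum_range_succ, show t + (n + 1) * L = t + n * L + L by ring, add_assoc]

/-- `t + nL → ∞` (uses `L ≥ 1`). [cite: BiswasJacobVanetti2019, §2.1 Theorem 2.5 ("for any
`L ≥ 1`")] -/
theorem tendsto_shift (t : ℕ) : Tendsto (fun n : ℕ => t + n * L) atTop atTop := by
  refine tendsto_atTop_atTop.2 fun b => ⟨b, fun n hn => ?_⟩
  have hL := A.one_le
  calc b ≤ n := hn
    _ = n * 1 := (mul_one n).symm
    _ ≤ n * L := Nat.mul_le_mul_left n hL
    _ ≤ t + n * L := Nat.le_add_left _ _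

/-- **THEOREM 2.5 (total-variation case), first half**: for every event `B` and every `t`,
`π_t(B) ≤ π(B) + Σ_{j≥1} P(τ^{(L)} > t + jL)` ("Seeing the invariant distribution `π` as the limit
of `π_t` … swapping expectation and limit"). [cite: BiswasJacobVanetti2019, §2.1 Theorem 2.5,
eq. (2.1)] -/
theorem measure_le_target_add (t : ℕ) {B : Set 𝒳} (hB : MeasurableSet B) :
    P (X t ⁻¹' B) ≤ target B + ∑' j, P {ω | t + (j + 1) * L < τ ω} := by
  have h1 : ∀ n, P (X t ⁻¹' B) ≤
      P (X (t + n * L) ⁻¹' B) + ∑' j, P {ω | t + (j + 1) * L < τ ω} := fun n =>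
    (A.measure_le_add_sum t n hB).trans (by gcongr; exact ENNReal.sum_le_tsum _)
  have hlim : Tendsto (fun n => P (X (t + n * L) ⁻¹' B) + ∑' j, P {ω | t + (j + 1) * L < τ ω})
      atTop (𝓝 (target B + ∑' j, P {ω | t + (j + 1) * L < τ ω})) :=
    (((A.tendsto B hB).comp (A.tendsto_shift t)).add_const _)
  exact ge_of_tendsto' hlim h1

/-- **THEOREM 2.5 (total-variation case), second half**: `π(B) ≤ π_t(B) + Σ_{j≥1} P(τ^{(L)} >
t + jL)`; together with `measure_le_target_add`: `|π_t(B) − π(B)| ≤ Σ_{j≥1} P(τ^{(L)} > t + jL)`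
for all `B`, i.e. `d_TV(π_t, π) ≤ E[max(0, ⌈(τ^{(L)} − L − t)/L⌉)]` (`tsum_measure_eq_lintegral`).
[cite: BiswasJacobVanetti2019, §2.1 Theorem 2.5, eq. (2.1)] -/
theorem target_le_measure_add (t : ℕ) {B : Set 𝒳} (hB : MeasurableSet B) :
    target B ≤ P (X t ⁻¹' B) + ∑' j, P {ω | t + (j + 1) * L < τ ω} := by
  have h1 : ∀ n, P (X (t + n * L) ⁻¹' B) ≤
      P (X t ⁻¹' B) + ∑' j, P {ω | t + (j + 1) * L < τ ω} := fun n =>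
    (A.measure_add_sum_ge t n hB).trans (by gcongr; exact ENNReal.sum_le_tsum _)
  exact le_of_tendsto' ((A.tendsto B hB).comp (A.tendsto_shift t)) h1

/-! ### The right-hand side as the printed expectation -/

/-- Counting the lag steps before the meeting: `#{j ≥ 1 : t + jL < τ} = ⌊(τ − t − 1)/L⌋`
(natural-number subtraction: `0` if `τ ≤ t`), `= max(0, ⌈(τ − L − t)/L⌉)` as printed.
[cite: BiswasJacobVanetti2019, §2.1 Theorem 2.5 (the ceiling in (2.1))] -/
theorem count_eq (t : ℕ) (ω : Ω) :
    ∑' j : ℕ, ({ω | t + (j + 1) * L < τ ω} : Set Ω).indicator (1 : Ω → ℝ≥0∞) ω =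
      (((τ ω - t - 1) / L : ℕ) : ℝ≥0∞) := by
  have hL : 0 < L := A.one_le
  have hiff : ∀ j : ℕ, t + (j + 1) * L < τ ω ↔ j < (τ ω - t - 1) / L := by
    intro j
    have h1 : t + (j + 1) * L < τ ω ↔ (j + 1) * L ≤ τ ω - t - 1 := by
      have hm : 0 < (j + 1) * L := Nat.mul_pos (Nat.succ_pos j) hL
      generalize (j + 1) * L = m at hm ⊢
      omega
    rw [h1, ← Nat.le_div_iff_mul_le hL]
    exact Nat.add_one_le_iff
  rw [tsum_eq_sum (s := range ((τ ω - t - 1) / L)) (fun j hj => ?_)]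
  · rw [Finset.sum_congr rfl fun j hj => Set.indicator_of_mem
      (show ω ∈ {ω | t + (j + 1) * L < τ ω} from (hiff j).2 (Finset.mem_range.1 hj))
      (1 : Ω → ℝ≥0∞)]
    simp
  · exact Set.indicator_of_notMem
      (show ω ∉ {ω | t + (j + 1) * L < τ ω} from fun h => hj (Finset.mem_range.2 ((hiff j).1 h)))
      (1 : Ω → ℝ≥0∞)

omit A in
/-- The natural-number count IS the printed integrand: `⌊(τ − t − 1)/L⌋₊ = max(0, ⌈(τ − L − t)/L⌉)`
for integers `τ, t ≥ 0`, `L ≥ 1` (exact rational arithmetic). [cite: BiswasJacobVanetti2019, §2.1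
Theorem 2.5, eq. (2.1)] -/
theorem count_eq_max_ceil {L : ℕ} (hL : 0 < L) (τ t : ℕ) :
    (((τ - t - 1) / L : ℕ) : ℤ) = max 0 ⌈((τ : ℚ) - L - t) / L⌉ := by
  have hLq : (0 : ℚ) < L := by exact_mod_cast hL
  rcases le_or_gt τ t with hle | hlt
  · -- no lag step before the meeting: both sides vanish
    have h0 : τ - t - 1 = 0 := by omega
    rw [h0, Nat.zero_div, Nat.cast_zero, eq_comm, max_eq_left_iff, Int.ceil_le, Int.cast_zero,
      div_nonpos_iff]
    right
    constructor
    · have : (τ : ℚ) ≤ t := by exact_mod_cast hle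
      linarith
    · exact hLq.le
  · -- `n = τ − t ≥ 1`, `K = ⌊(n−1)/L⌋`: `K L ≤ n − 1 < (K+1) L`, so `⌈(n − L)/L⌉ = K ≥ 0`
    set K := (τ - t - 1) / L with hK
    have h1 : K * L ≤ τ - t - 1 := Nat.div_mul_le_self _ _
    have h2 : τ - t - 1 < K * L + L := Nat.lt_div_mul_add hL
    have h1q : ((K : ℚ) * L) ≤ (τ : ℚ) - t - 1 := by
      have : ((K * L : ℕ) : ℚ) ≤ ((τ - t - 1 : ℕ) : ℚ) := by exact_mod_cast h1
      rw [Nat.cast_mul, Nat.cast_sub (by omega), Nat.cast_sub (by omega)] at this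
      simpa using this
    have h2' : τ - t ≤ K * L + L := by
      have h3 := Nat.succ_le_of_lt h2
      generalize K * L = m at h3 ⊢
      omega
    have h2q : (τ : ℚ) - t ≤ (K : ℚ) * L + L := by
      have : ((τ - t : ℕ) : ℚ) ≤ ((K * L + L : ℕ) : ℚ) := by exact_mod_cast h2'
      rw [Nat.cast_add, Nat.cast_mul, Nat.cast_sub (by omega)] at this
      simpa using this
    have hceil : ⌈((τ : ℚ) - L - t) / L⌉ = (K : ℤ) := by
      rw [Int.ceil_eq_iff, Int.cast_natCast, lt_div_iff₀ hLq, div_le_iff₀ hLq]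
      constructor
      · linarith
      · linarith
    rw [hceil, max_eq_right (Int.natCast_nonneg _)]

/-- **The right-hand side of (2.1) is the printed expectation**:
`Σ_{j≥1} P(τ^{(L)} > t + jL) = E[⌊(τ^{(L)} − t − 1)/L⌋] = E[max(0, ⌈(τ^{(L)} − L − t)/L⌉)]`
("swapping expectation and limit"). [cite: BiswasJacobVanetti2019, §2.1 Theorem 2.5, eq. (2.1)] -/
theorem tsum_measure_eq_lintegral (t : ℕ) :
    ∑' j, P {ω | t + (j + 1) * L < τ ω} = ∫⁻ ω, (((τ ω - t - 1) / L : ℕ) : ℝ≥0∞) ∂P := by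
  -- `{τ > m}` is an event (as in `UnbiasedCoupling.Assumptions.measurableSet_lt_tau`, whose module
  -- is not yet built, hence not importable here)
  have hmeas : ∀ m : ℕ, MeasurableSet {ω | m < τ ω} := fun m =>
    A.measurable_τ ((Set.to_countable (Set.Ioi m)).measurableSet)
  simp_rw [← A.count_eq t]
  rw [lintegral_tsum fun j => (measurable_one.indicator (hmeas _)).aemeasurable]
  simp_rw [lintegral_indicator_one (hmeas _)]

end Assumptions

/-! ### Non-vacuity of the hypotheses -/

/-- The assumptions are jointly satisfiable (sanity check, not in the source): two copies of the
constant chain at `x₀`, lag `L = 1`, meeting time `0`, target `δ_{x₀}`.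
[cite: BiswasJacobVanetti2019, §2.1 Assumptions 2.2–2.4] -/
theorem Assumptions.of_const (P : Measure Ω) [IsProbabilityMeasure P] (x₀ : 𝒳) :
    Assumptions P (fun _ _ => x₀) (fun _ _ => x₀) (fun _ => 0) 1 (Measure.dirac x₀) where
  one_le := le_rfl
  measurable_X := fun _ => measurable_const
  measurable_Y := fun _ => measurable_const
  identDistrib := fun _ => IdentDistrib.refl measurable_const.aemeasurable
  tendsto := fun B hB => by
    have e : (fun _ : ℕ => P ((fun _ : Ω => x₀) ⁻¹' B)) = fun _ => Measure.dirac x₀ B := by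
      funext
      rw [Measure.dirac_apply' _ hB]
      by_cases hx : x₀ ∈ B
      · rw [Set.preimage_const_of_mem hx, Set.indicator_of_mem hx, measure_univ, Pi.one_apply]
      · rw [Set.preimage_const_of_notMem hx, Set.indicator_of_notMem hx, measure_empty]
    rw [e]
    exact tendsto_const_nhds
  measurable_τ := measurable_const
  faithful := fun _ _ _ => rfl


/-! ## Theorem 2.5 for an integral probability metric (one test function at a time)

Source, VERBATIM [BiswasJacobVanetti2019, §2 Definition 2.1 and §2.1 Theorem 2.5]: "Let `ℋ` be a
class of real-valued functions on a measurable space `𝒳`. For all probability measures `P, Q` on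
`𝒳`, the corresponding IPM is defined as: `d_ℋ(P, Q) := sup_{h ∈ ℋ} |E_{X∼P}[h(X)] − E_{X∼Q}[h(X)]|`.
… Our proposed method applies to IPMs such that `sup_{h∈ℋ} |h(x) − h(y)| ≤ M_ℋ(x,y)` for all
`x, y ∈ 𝒳`, for some computable function `M_ℋ` on `𝒳 × 𝒳`. For `d_TV` we have `M_ℋ(x,y) = 1`, and
for `d_W` we have `M_ℋ(x,y) = d_𝒳(x, y)`." **"Theorem 2.5.** (Upper bounds.) For an IPM with
function set `ℋ` and upper bound `M_ℋ`, with the Markov chains `(X_t)`, `(Y_t)` satisfying the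
above assumptions, for any `L ≥ 1`, and any `t ≥ 0`,
`d_ℋ(π_t, π) ≤ E[Σ_{j=1}^{⌈(τ^{(L)} − L − t)/L⌉} M_ℋ(X_{t+jL}, Y_{t+(j−1)L})]`. … When
`⌈(τ^{(L)} − L − t)/L⌉ ≤ 0`, the sum … is set to zero by convention." and (2.2):
"`d_W(π_t, π) ≤ E[Σ_{j=1}^{⌈(τ^{(L)} − L −t)/L⌉} d_𝒳(X_{t+jL}, Y_{t+(j−1)L})]`."

Lean reading.  The IPM bound is the supremum over `h ∈ ℋ` of a ONE-FUNCTION bound, which is what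
is typed: for a measurable real `h` with `E[h(X_t)] → E_π[h]` (Assumption 2.2 for this `h`),
`h(X_s)` integrable, and a measurable `M : 𝒳 × 𝒳 → [0, ∞]` with `|h(x) − h(y)| ≤ M(x,y)`,
`|E[h(X_t)] − E_π[h]| ≤ E[Σ_{j ≥ 1} 1{t + jL < τ} M(X_{t+jL}, Y_{t+(j−1)L})]`
(`integral_sub_target_le`), the sum running exactly over `j ≤ ⌈(τ − L − t)/L⌉` (the indicator;
cf. `count_eq` / `count_eq_max_ceil`).  The 1-Wasserstein case (2.2) is the instance
`M = edist`, `h` 1-Lipschitz (`integral_sub_target_le_of_lipschitz`).  The total-variation case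
(2.1) is the set-wise statement above (`measure_le_target_add`, `target_le_measure_add`).
-/

namespace Assumptions

variable {P : Measure Ω} {X Y : ℕ → Ω → 𝒳} {τ : Ω → ℕ} {L : ℕ} {target : Measure 𝒳}
  (A : Assumptions P X Y τ L target)
include A

/-- Same marginals, for expectations: `E[h(X_t)] = E[h(Y_t)]`.
[cite: BiswasJacobVanetti2019, §6.1 ("marginally have the same … kernel `K`")] -/
theorem integral_X_eq_Y (t : ℕ) {h : 𝒳 → ℝ} (hm : Measurable h) :
    ∫ ω, h (X t ω) ∂P = ∫ ω, h (Y t ω) ∂P :=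
  ((A.identDistrib t).comp hm).integral_eq

/-- **One lag step for a test function**: `|E h(Y_s) − E h(X_{s+L})| ≤ E[1{s + L < τ} M(X_{s+L},
Y_s)]` when `|h(x) − h(y)| ≤ M(x,y)` (faithfulness kills the integrand on `{τ ≤ s + L}`).
[cite: BiswasJacobVanetti2019, §2.1 (sketch: "`d_ℋ(π_s, π_t) ≤ E[M_ℋ(X_s, X_t)]`", "terms
indexed by `j > ⌈(τ^{(L)} − L − t)/L⌉` are equal to zero by Assumption 2.4")] -/
theorem ofReal_abs_sub_le_step (s : ℕ) {h : 𝒳 → ℝ}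
    (hiX : Integrable (fun ω => h (X (s + L) ω)) P) (hiY : Integrable (fun ω => h (Y s ω)) P)
    {M : 𝒳 → 𝒳 → ℝ≥0∞} (hM : ∀ x y, ENNReal.ofReal |h x - h y| ≤ M x y) :
    ENNReal.ofReal |∫ ω, h (Y s ω) ∂P - ∫ ω, h (X (s + L) ω) ∂P| ≤
      ∫⁻ ω, {ω | s + L < τ ω}.indicator (fun ω => M (X (s + L) ω) (Y s ω)) ω ∂P := by
  rw [← integral_sub hiY hiX]
  calc ENNReal.ofReal |∫ ω, (h (Y s ω) - h (X (s + L) ω)) ∂P|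
      ≤ ∫⁻ ω, ‖h (Y s ω) - h (X (s + L) ω)‖ₑ ∂P := by
        rw [← Real.norm_eq_abs, ofReal_norm]
        exact enorm_integral_le_lintegral_enorm _
    _ ≤ ∫⁻ ω, {ω | s + L < τ ω}.indicator (fun ω => M (X (s + L) ω) (Y s ω)) ω ∂P := by
        refine lintegral_mono fun ω => ?_
        by_cases hτ : τ ω ≤ s + L
        · have e := A.faithful ω (s + L) hτ
          rw [Nat.add_sub_cancel] at e
          rw [e, sub_self, enorm_zero]
          exact zero_le
        · rw [Set.indicator_of_mem (show ω ∈ {ω | s + L < τ ω} from not_le.1 hτ)]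
          rw [Real.enorm_eq_ofReal_abs, abs_sub_comm]
          exact hM _ _

/-- **`n` lag steps, telescoped**: `|E h(X_t) − E h(X_{t+nL})| ≤ Σ_{j=1}^{n} E[1{t + jL < τ}
M(X_{t+jL}, Y_{t+(j−1)L})]` ("applying triangle inequalities").
[cite: BiswasJacobVanetti2019, §2.1 (sketch)] -/
theorem ofReal_abs_sub_le_sum (t n : ℕ) {h : 𝒳 → ℝ} (hm : Measurable h)
    (hi : ∀ s, Integrable (fun ω => h (X s ω)) P)
    {M : 𝒳 → 𝒳 → ℝ≥0∞} (hM : ∀ x y, ENNReal.ofReal |h x - h y| ≤ M x y) :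
    ENNReal.ofReal |∫ ω, h (X t ω) ∂P - ∫ ω, h (X (t + n * L) ω) ∂P| ≤
      ∑ j ∈ range n, ∫⁻ ω, {ω | t + (j + 1) * L < τ ω}.indicator
        (fun ω => M (X (t + (j + 1) * L) ω) (Y (t + j * L) ω)) ω ∂P := by
  have hiY : ∀ s, Integrable (fun ω => h (Y s ω)) P := fun s =>
    (((A.identDistrib s).comp hm).integrable_iff).mp (hi s)
  induction n with
  | zero => simp
  | succ n ih =>
    have hstep := A.ofReal_abs_sub_le_step (t + n * L)
      (by simpa [show t + n * L + L = t + (n + 1) * L by ring] using hi (t + (n + 1) * L))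
      (hiY (t + n * L)) hM
    rw [A.integral_X_eq_Y (t + n * L) hm] at ih
    calc ENNReal.ofReal |∫ ω, h (X t ω) ∂P - ∫ ω, h (X (t + (n + 1) * L) ω) ∂P|
        ≤ ENNReal.ofReal (|∫ ω, h (X t ω) ∂P - ∫ ω, h (Y (t + n * L) ω) ∂P| +
            |∫ ω, h (Y (t + n * L) ω) ∂P - ∫ ω, h (X (t + (n + 1) * L) ω) ∂P|) :=
          ENNReal.ofReal_le_ofReal (abs_sub_le _ _ _)
      _ ≤ ENNReal.ofReal |∫ ω, h (X t ω) ∂P - ∫ ω, h (Y (t + n * L) ω) ∂P| +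
            ENNReal.ofReal |∫ ω, h (Y (t + n * L) ω) ∂P - ∫ ω, h (X (t + (n + 1) * L) ω) ∂P| :=
          ENNReal.ofReal_add_le
      _ ≤ (∑ j ∈ range n, ∫⁻ ω, {ω | t + (j + 1) * L < τ ω}.indicator
            (fun ω => M (X (t + (j + 1) * L) ω) (Y (t + j * L) ω)) ω ∂P) +
            ∫⁻ ω, {ω | t + n * L + L < τ ω}.indicator
              (fun ω => M (X (t + n * L + L) ω) (Y (t + n * L) ω)) ω ∂P :=
          add_le_add ih (by simpa [show t + n * L + L = t + (n + 1) * L by ring] using hstep)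
      _ = ∑ j ∈ range (n + 1), ∫⁻ ω, {ω | t + (j + 1) * L < τ ω}.indicator
            (fun ω => M (X (t + (j + 1) * L) ω) (Y (t + j * L) ω)) ω ∂P := by
          rw [Finset.sum_range_succ, show t + n * L + L = t + (n + 1) * L by ring]

/-- **THEOREM 2.5 for one test function** (hence for the IPM, by taking the supremum over
`h ∈ ℋ`): if `E[h(X_t)] → E_π[h]` (Assumption 2.2 for `h`) and `|h(x) − h(y)| ≤ M(x, y)`, then
`|E[h(X_t)] − E_π[h]| ≤ E[Σ_{j≥1} 1{t + jL < τ^{(L)}} M(X_{t+jL}, Y_{t+(j−1)L})]`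
`= E[Σ_{j=1}^{⌈(τ^{(L)} − L − t)/L⌉} M(X_{t+jL}, Y_{t+(j−1)L})]`.
[cite: BiswasJacobVanetti2019, §2.1 Theorem 2.5 (eq:ipm_upper_bound)] -/
theorem integral_sub_target_le (t : ℕ) {h : 𝒳 → ℝ} (hm : Measurable h)
    (hi : ∀ s, Integrable (fun ω => h (X s ω)) P)
    (hconv : Tendsto (fun s => ∫ ω, h (X s ω) ∂P) atTop (𝓝 (∫ x, h x ∂target)))
    {M : 𝒳 → 𝒳 → ℝ≥0∞} (hMm : Measurable (Function.uncurry M))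
    (hM : ∀ x y, ENNReal.ofReal |h x - h y| ≤ M x y) :
    ENNReal.ofReal |∫ ω, h (X t ω) ∂P - ∫ x, h x ∂target| ≤
      ∫⁻ ω, ∑' j, {ω | t + (j + 1) * L < τ ω}.indicator
        (fun ω => M (X (t + (j + 1) * L) ω) (Y (t + j * L) ω)) ω ∂P := by
  have hmeas : ∀ j, AEMeasurable ({ω | t + (j + 1) * L < τ ω}.indicator
      (fun ω => M (X (t + (j + 1) * L) ω) (Y (t + j * L) ω))) P := by
    intro j
    refine (Measurable.indicator ?_ ?_).aemeasurable
    · exact hMm.comp ((A.measurable_X _).prodMk (A.measurable_Y _))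
    · exact A.measurable_τ ((Set.to_countable (Set.Ioi (t + (j + 1) * L))).measurableSet)
  rw [lintegral_tsum hmeas]
  have h1 : ∀ n, ENNReal.ofReal |∫ ω, h (X t ω) ∂P - ∫ ω, h (X (t + n * L) ω) ∂P| ≤
      ∑' j, ∫⁻ ω, {ω | t + (j + 1) * L < τ ω}.indicator
        (fun ω => M (X (t + (j + 1) * L) ω) (Y (t + j * L) ω)) ω ∂P := fun n =>
    (A.ofReal_abs_sub_le_sum t n hm hi hM).trans (ENNReal.sum_le_tsum _)
  have hlim : Tendsto (fun n => ENNReal.ofReal |∫ ω, h (X t ω) ∂P - ∫ ω, h (X (t + n * L) ω) ∂P|)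
      atTop (𝓝 (ENNReal.ofReal |∫ ω, h (X t ω) ∂P - ∫ x, h x ∂target|)) :=
    ENNReal.tendsto_ofReal ((tendsto_const_nhds.sub (hconv.comp (A.tendsto_shift t))).abs)
  exact le_of_tendsto' hlim h1

end Assumptions

/-- **THEOREM 2.5, the 1-Wasserstein case (2.2), one 1-Lipschitz function at a time**: in a
(pseudo-e)metric state space, for `h` 1-Lipschitz with `E[h(X_t)] → E_π[h]`,
`|E[h(X_t)] − E_π[h]| ≤ E[Σ_{j=1}^{⌈(τ^{(L)} − L − t)/L⌉} d_𝒳(X_{t+jL}, Y_{t+(j−1)L})]`.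
[cite: BiswasJacobVanetti2019, §2.1 eq. (2.2) (`M_ℋ = d_𝒳` for `d_W`)] -/
theorem Assumptions.integral_sub_target_le_of_lipschitz {P : Measure Ω} {τ : Ω → ℕ} {L : ℕ} {𝒴 : Type*} [PseudoEMetricSpace 𝒴]
    [MeasurableSpace 𝒴] [OpensMeasurableSpace 𝒴] [SecondCountableTopology 𝒴]
    {X' Y' : ℕ → Ω → 𝒴} {target' : Measure 𝒴} (A' : Assumptions P X' Y' τ L target') (t : ℕ)
    {h : 𝒴 → ℝ} (hh : LipschitzWith 1 h) (hi : ∀ s, Integrable (fun ω => h (X' s ω)) P)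
    (hconv : Tendsto (fun s => ∫ ω, h (X' s ω) ∂P) atTop (𝓝 (∫ x, h x ∂target'))) :
    ENNReal.ofReal |∫ ω, h (X' t ω) ∂P - ∫ x, h x ∂target'| ≤
      ∫⁻ ω, ∑' j, {ω | t + (j + 1) * L < τ ω}.indicator
        (fun ω => edist (X' (t + (j + 1) * L) ω) (Y' (t + j * L) ω)) ω ∂P := by
  refine A'.integral_sub_target_le t hh.continuous.measurable hi hconv
    (M := fun x y => edist x y) measurable_edist fun x y => ?_
  calc ENNReal.ofReal |h x - h y| = edist (h x) (h y) := by rw [edist_dist, Real.dist_eq]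
    _ ≤ ((1 : ℝ≥0) : ℝ≥0∞) * edist x y := hh x y
    _ = edist x y := by simp


end LLagCoupling

end Literature.Probability.MarkovChains

end
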